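import Summits.BirchSwinnertonDyer.BirchSwinnertonDyer.Theorems.SylvesterTwoHeegnerIndexUpperOffV0DualityTwoCore
import HarnessLib

/-!
# McCallum's Lemma 5.3 at `p = 2`: the defect ONE is invariant under twisting the involution by `μ₆`

Helper file of route `SylvesterTwoHeegnerIndex` (K7t), crux `UpperOffV0HSYPlus` (item 19804; record twin
19581), line `offv0-kolyvagin2`; sequel of `…UpperOffV0DualityTwoCore` (k7t-c2 g4: in the frame
`θ² + θ + 1 = 0` on `N` of order `4^M`, `τ` a `θ`-semilinear additive map fixing a point `P` of order `2^M`
— `N = E[2^M]`, `θ = [ω]`, `τ` = complex conjugation for `y² = x³ − c` — the eigen-pairing conclusion of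
Lemma 5.3 holds with defect exactly one: `pow_nsmul_eq_zero_of_pairing_eigen_two` /
`exists_pairing_eigen_defect_witness`).  THEOREMS ONLY; typed piece of the obstruction, not the crux.

At an inert Kolyvagin prime the local involution is the image `T` of an arithmetic Frobenius on `E[2^M]`;
besides `T = τ` (Gross (3.2)) the only Čebotarev classes with `T² = 1` on `E[2^M]` are the TWISTS
`τ ∘ [ζ]`, `ζ ∈ μ₆ = {±1, ±ω, ±ω²}` (up to `𝒪^×`-conjugacy).  One might hope that re-choosing the
Frobenius class among them repairs the defect.  It does not: **every twist `±τ ∘ θ^j` is again an instance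
of the SAME frame** (semilinear, with a fixed point of order `2^M`: `θP` for `τ∘θ`, `P + 2θP` for `−τ`),
so g4's two theorems apply to it verbatim — defect one, and sharp.  Recorded here:

* `comp_theta_semilinear`, `comp_theta_fix` — `τ ∘ θ` is `θ`-semilinear and fixes `θP`;
* `neg_semilinear`, `neg_fix`, `addOrderOf_P_add_two_theta` — `−τ` is `θ`-semilinear and fixes
  `P + 2θP`, a point of order `2^M`;
* `pow_nsmul_eq_zero_of_pairing_eigen_two_comp_theta` / `…_neg` — Lemma 5.3 at `2` with defect one for
  the twisted involutions; `exists_pairing_eigen_defect_witness_comp_theta` / `…_neg` — sharpness;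
  `…_comp_theta_theta` (iterate once more) covers `τ ∘ θ²`, and `neg` the remaining signs.

Reading (memo STUB-AUDIT-19804-k7t-c2-g5 §5): the `δ = 1` of the 2-adic Kolyvagin count is intrinsic to
«inert Kolyvagin prime + same-sign `τ`-eigenclasses» and cannot be removed by a re-choice of primes.
References: [McCallumLMS1991] §5 Lemma 5.3; [GrossLMS1991] §8 Prop. 8.1–8.2, (7.6).
-/

set_option autoImplicit false
set_option linter.dupNamespace false

namespace Summit.BirchSwinnertonDyer.BirchSwinnertonDyer.Theorems.SylvesterTwoUpper.EisensteinTorsion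

open Literature.NumberTheory.EllipticCurves

variable {N : Type*} [AddCommGroup N] (θ : N →+ N) (hθ : ∀ x, θ (θ x) + θ x + x = 0)
  (τ : N →+ N) (hτθ : ∀ x, τ (θ x) = θ (θ (τ x))) {P : N} (hτP : τ P = P)

/-! ## §1 The twists stay in the frame -/

include hθ in
/-- `θ³ = 1` from `θ² + θ + 1 = 0`. [folklore] -/
theorem theta_theta_theta (x : N) : θ (θ (θ x)) = x := by
  have h1 := hθ (θ x)
  have h2 := hθ x
  -- `θ³x + θ²x + θx = 0` and `θ²x + θx + x = 0`
  have : θ (θ (θ x)) - x = 0 := by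
    have e : θ (θ (θ x)) - x = (θ (θ (θ x)) + θ (θ x) + θ x) - (θ (θ x) + θ x + x) := by abel
    rw [e, h1, h2, sub_zero]
  exact sub_eq_zero.mp this

include hτθ in
/-- **`τ ∘ θ` is again `θ`-semilinear**: `(τθ)(θx) = θ²((τθ)x)` (both sides equal `θ⁴τx = θτx`).
[folklore] -/
theorem comp_theta_semilinear (x : N) : (τ.comp θ) (θ x) = θ (θ ((τ.comp θ) x)) := by
  simp only [AddMonoidHom.coe_comp, Function.comp_apply]
  exact hτθ (θ x)

include hθ hτθ hτP in
/-- **`τ ∘ θ` fixes `θP`**: `τ(θ²P) = θ⁴ τP = θP`. [folklore] -/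
theorem comp_theta_fix : (τ.comp θ) (θ P) = θ P := by
  simp only [AddMonoidHom.coe_comp, Function.comp_apply]
  rw [hτθ (θ P), hτθ P, hτP, theta_theta_theta θ hθ]

include hτθ in
/-- **`−τ` is `θ`-semilinear.** [folklore] -/
theorem neg_semilinear (x : N) : (-τ) (θ x) = θ (θ ((-τ) x)) := by
  simp only [AddMonoidHom.neg_apply, map_neg, hτθ x]

variable [Finite N] {M : ℕ} (hcard : Nat.card N = 4 ^ M) (hP : addOrderOf P = 2 ^ M)

include hθ hτθ hτP hcard hP in
/-- **`−τ` fixes `P + 2θP`** (the `τ`-anti-fixed line of `…EisensteinConj.tau_eq_neg_iff`).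
[folklore] -/
theorem neg_fix : (-τ) (P + (2 : ℤ) • θ P) = P + (2 : ℤ) • θ P := by
  have h : τ (P + (2 : ℤ) • θ P) = -(P + (2 : ℤ) • θ P) :=
    (tau_eq_neg_iff θ hθ τ hτθ hτP hcard hP _).mpr ⟨1, by rw [one_zsmul]⟩
  rw [AddMonoidHom.neg_apply, h, neg_neg]

include hθ hcard hP in
/-- `P + 2θP` has order `2^M` (coordinates `(1, 2)`, not both even). [folklore] -/
theorem addOrderOf_P_add_two_theta (hM : 1 ≤ M) : addOrderOf (P + (2 : ℤ) • θ P) = 2 ^ M := by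
  have h := addOrderOf_lin_eq_two_pow θ hθ hcard hP hM (a := 1) (b := 2) (by omega)
  rwa [one_zsmul] at h

/-! ## §2 Lemma 5.3 at `2` for the twisted involutions: defect one, and sharp -/

include hθ hτθ hτP hcard hP in
/-- **Lemma 5.3 at `2` with defect one for the twisted involution `τ ∘ θ`** (the Frobenius class
`τ ∘ [ω]`): for an alternating left-non-degenerate `e`, `x ∈ N^{τθ = ν}`, `y ∈ N^{τθ = −ν}`, `2^a y ≠ 0`,
`e(x, y) = 0` ⟹ `2^{M−a} x = 0` — g4's `pow_nsmul_eq_zero_of_pairing_eigen_two` in the frame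
`(τ ∘ θ, θP)`. [cite: McCallumLMS1991, §5 Lemma 5.3] -/
theorem pow_nsmul_eq_zero_of_pairing_eigen_two_comp_theta (hM : 1 ≤ M) {A : Type*} [AddCommGroup A]
    (e : N →+ N →+ A) (halt : ∀ x, e x x = 0) (hnd : ∀ x, (∀ y, e x y = 0) → x = 0)
    {ν : ℤ} (hν : ν = 1 ∨ ν = -1) {x y : N} (hx : (τ.comp θ) x = ν • x)
    (hy : (τ.comp θ) y = -(ν • y)) {a : ℕ} (ha : 2 ^ a • y ≠ 0) (hexy : e x y = 0) :
    2 ^ (M - a) • x = 0 :=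
  pow_nsmul_eq_zero_of_pairing_eigen_two θ hθ (τ.comp θ) (comp_theta_semilinear θ τ hτθ)
    (comp_theta_fix θ hθ τ hτθ hτP) hcard (addOrderOf_theta_eq θ hθ hcard hP hM) hM e halt hnd hν
    hx hy ha hexy

include hθ hτθ hτP hcard hP in
/-- **…and the defect one is SHARP for `τ ∘ θ`**: g4's `exists_pairing_eigen_defect_witness` in the
frame `(τ ∘ θ, θP)` — for every alternating `e` there are `x ∈ N^{τθ = 1}`, `y ∈ N^{τθ = −1}`, `a` with
`2^a y ≠ 0`, `e(x, y) = 0` and `2^{M−1−a} x ≠ 0`. [cite: McCallumLMS1991, §5 Lemma 5.3] -/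
theorem exists_pairing_eigen_defect_witness_comp_theta (hM : 1 ≤ M) {A : Type*} [AddCommGroup A]
    (e : N →+ N →+ A) (halt : ∀ x, e x x = 0) :
    ∃ (x y : N) (a : ℕ), (τ.comp θ) x = x ∧ (τ.comp θ) y = -y ∧ 2 ^ a • y ≠ 0 ∧ e x y = 0 ∧
      2 ^ (M - 1 - a) • x ≠ 0 :=
  exists_pairing_eigen_defect_witness θ hθ (τ.comp θ) (comp_theta_semilinear θ τ hτθ)
    (comp_theta_fix θ hθ τ hτθ hτP) hcard (addOrderOf_theta_eq θ hθ hcard hP hM) hM e halt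

include hθ hτθ hτP hcard hP in
/-- **Lemma 5.3 at `2` with defect one for `−τ`** (the Frobenius class `τ ∘ [−1]`; its eigenlines
are those of `τ` with the signs exchanged): g4's theorem in the frame `(−τ, P + 2θP)`.
[cite: McCallumLMS1991, §5 Lemma 5.3] -/
theorem pow_nsmul_eq_zero_of_pairing_eigen_two_neg (hM : 1 ≤ M) {A : Type*} [AddCommGroup A]
    (e : N →+ N →+ A) (halt : ∀ x, e x x = 0) (hnd : ∀ x, (∀ y, e x y = 0) → x = 0)
    {ν : ℤ} (hν : ν = 1 ∨ ν = -1) {x y : N} (hx : (-τ) x = ν • x)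
    (hy : (-τ) y = -(ν • y)) {a : ℕ} (ha : 2 ^ a • y ≠ 0) (hexy : e x y = 0) :
    2 ^ (M - a) • x = 0 :=
  pow_nsmul_eq_zero_of_pairing_eigen_two θ hθ (-τ) (neg_semilinear θ τ hτθ)
    (neg_fix θ hθ τ hτθ hτP hcard hP) hcard (addOrderOf_P_add_two_theta θ hθ hcard hP hM) hM e halt
    hnd hν hx hy ha hexy

include hθ hτθ hτP hcard hP in
/-- **…and sharp for `−τ`.** [cite: McCallumLMS1991, §5 Lemma 5.3] -/
theorem exists_pairing_eigen_defect_witness_neg (hM : 1 ≤ M) {A : Type*} [AddCommGroup A]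
    (e : N →+ N →+ A) (halt : ∀ x, e x x = 0) :
    ∃ (x y : N) (a : ℕ), (-τ) x = x ∧ (-τ) y = -y ∧ 2 ^ a • y ≠ 0 ∧ e x y = 0 ∧
      2 ^ (M - 1 - a) • x ≠ 0 :=
  exists_pairing_eigen_defect_witness θ hθ (-τ) (neg_semilinear θ τ hτθ)
    (neg_fix θ hθ τ hτθ hτP hcard hP) hcard (addOrderOf_P_add_two_theta θ hθ hcard hP hM) hM e halt

include hθ hτθ hτP hcard hP in
/-- **The remaining twist `τ ∘ θ²`** (Frobenius class `τ ∘ [ω²]`): the frame is stable under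
`τ ↦ τ ∘ θ`, so iterating `…_comp_theta` once more gives Lemma 5.3 at `2` with defect one for
`(τ ∘ θ) ∘ θ`; with `…_neg` this covers all six `±τ ∘ θ^j`. [cite: McCallumLMS1991, §5 Lemma 5.3] -/
theorem pow_nsmul_eq_zero_of_pairing_eigen_two_comp_theta_theta (hM : 1 ≤ M) {A : Type*}
    [AddCommGroup A] (e : N →+ N →+ A) (halt : ∀ x, e x x = 0) (hnd : ∀ x, (∀ y, e x y = 0) → x = 0)
    {ν : ℤ} (hν : ν = 1 ∨ ν = -1) {x y : N} (hx : ((τ.comp θ).comp θ) x = ν • x)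
    (hy : ((τ.comp θ).comp θ) y = -(ν • y)) {a : ℕ} (ha : 2 ^ a • y ≠ 0) (hexy : e x y = 0) :
    2 ^ (M - a) • x = 0 :=
  pow_nsmul_eq_zero_of_pairing_eigen_two_comp_theta θ hθ (τ.comp θ) (comp_theta_semilinear θ τ hτθ)
    (P := θ P) (comp_theta_fix θ hθ τ hτθ hτP) hcard (addOrderOf_theta_eq θ hθ hcard hP hM) hM e halt
    hnd hν hx hy ha hexy

include hθ hτθ hτP hcard hP in
/-- **…and sharp for `τ ∘ θ²`.** [cite: McCallumLMS1991, §5 Lemma 5.3] -/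
theorem exists_pairing_eigen_defect_witness_comp_theta_theta (hM : 1 ≤ M) {A : Type*}
    [AddCommGroup A] (e : N →+ N →+ A) (halt : ∀ x, e x x = 0) :
    ∃ (x y : N) (a : ℕ), ((τ.comp θ).comp θ) x = x ∧ ((τ.comp θ).comp θ) y = -y ∧ 2 ^ a • y ≠ 0 ∧
      e x y = 0 ∧ 2 ^ (M - 1 - a) • x ≠ 0 :=
  exists_pairing_eigen_defect_witness_comp_theta θ hθ (τ.comp θ) (comp_theta_semilinear θ τ hτθ)
    (P := θ P) (comp_theta_fix θ hθ τ hτθ hτP) hcard (addOrderOf_theta_eq θ hθ hcard hP hM) hM e halt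

end Summit.BirchSwinnertonDyer.BirchSwinnertonDyer.Theorems.SylvesterTwoUpper.EisensteinTorsion
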